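import Literature.NumberTheory.Automorphic.QuaternionRamificationParity
import Literature.NumberTheory.Automorphic.QuaternionAlgebraAdelicRamificationProofs
import Literature.NumberTheory.Automorphic.AdicCompletionUnitNorms
import Literature.NumberTheory.Automorphic.AdeleRingTopology
import HarnessLib

/-!
# An adelic solution of `s² - a t² = b` away from the ramified places of `ℍ[K,a,b]`

Topic `NumberTheory/Automorphic`; theorems only (no definition, no named fact, no instance).

Let `K` be a number field, `a, b ∈ Kˣ` and `S` a finite set of finite places of `K`. If
`x² - a y² = b` is solvable in `K_v` for every finite `v ∉ S` and in `K_w` for every infinite place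
`w`, then there are **adeles** `s, t ∈ 𝔸_K` with `s_w² - a t_w² = b` at every infinite place and
`s_v² - a t_v² = b` at every finite `v ∉ S` (`exists_adele_sq_sub_mul_sq`): at the (cofinitely many)
finite places where `a`, `b`, `2` are units, Hensel's lemma gives *integral* solutions
(`exists_integral_sq_sub_mul_sq`, from `exists_sq_sub_mul_sq_of_isUnit` of `AdicCompletionUnitNorms`;
Vignéras, LNM 800, Ch. II §1 Lemme 1.10), so that the chosen local solutions form an adele.

For a quaternion algebra `D ≃ ℍ[K,a,b]` unramified at infinity and `S ⊇ Ram_f(D)` the hypotheses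
hold (`isSplitAt_quaternionAlgebra_iff`, `isSplitAtInfinite_quaternionAlgebra_iff`, transported
along `D ≃ ℍ[K,a,b]` by `isSplitAt_congr`, `isSplitAtInfinite_congr`), whence
`exists_adele_sq_sub_mul_sq_of_ramifiedPlaces_subset`: the input for splitting `D` over the adeles
away from `S`, `𝔸_K^S ⊗_K D ≅ ℍ[𝔸_K^S, a, b] ≅ M₂(𝔸_K^S)` (`QuaternionAlgebra.splitEquiv` of
`QuaternionSplitMatrixModel` over the ring `𝔸_K^S`), i.e. Gelbart's identification `G'^S = G^S`
of `D^{S,×}` with `GL₂(𝔸_K^S)` (Gelbart (1975), §10, p. 153), used in the comparison of the trace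
formulas (10.14) = (10.15). Part of the inline (D-0026) decomposition of
`Literature.NumberTheory.Automorphic.strong_multiplicity_one_quaternionUnits`.

## References

* M.-F. Vignéras, *Arithmétique des algèbres de quaternions*, LNM 800 (1980), Ch. II §1 Lemme 1.10,
  Ch. III §1 (proof of Lemme 1.1), §3 [VignerasLNM800].
* S. Gelbart, *Automorphic forms on adele groups*, Ann. of Math. Studies 83 (1975), §10, p. 153
  [Gelbart1975].
-/

noncomputable section

open scoped Quaternion
open NumberField IsDedekindDomain Valued

universe u

namespace Literature.NumberTheory.Automorphic

section NormEquation

variable (K : Type) [Field K] [NumberField K]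

/-- **Integral solutions at the good places** (Hensel; Vignéras II §1 Lemme 1.10): if `a`, `b` and
`2` are `v`-adic units then `x² - a y² = b` has a solution with `x, y ∈ 𝒪_v`.
[cite: VignerasLNM800, Ch. II §1 Lemme 1.10] -/
theorem exists_integral_sq_sub_mul_sq {a b : K} (v : HeightOneSpectrum (𝓞 K))
    (hva : v.valuation K a = 1) (hvb : v.valuation K b = 1) (hv2 : v.valuation K (2 : K) = 1) :
    ∃ x y : v.adicCompletion K, x ∈ v.adicCompletionIntegers K ∧ y ∈ v.adicCompletionIntegers K ∧
      x ^ 2 - algebraMap K _ a * y ^ 2 = algebraMap K _ b := by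
  set F := v.adicCompletion K with hF
  haveI : HenselianLocalRing 𝒪[F] := inferInstanceAs (HenselianLocalRing (v.adicCompletionIntegers K))
  haveI : Finite 𝓀[F] := finite_residueField_adicCompletion K v
  have hval : ∀ c : K, Valued.v (algebraMap K F c) = v.valuation K c :=
    fun c ↦ HeightOneSpectrum.valuedAdicCompletion_eq_valuation' v c
  have hint : (Valued.v (R := F)).Integers 𝒪[F] := Valuation.integer.integers _
  have hmem : ∀ {c : K}, v.valuation K c = 1 → algebraMap K F c ∈ 𝒪[F] := fun {c} hc ↦ by
    rw [Valuation.mem_integer_iff, hval, hc]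
  have hunit : ∀ {c : K} (hc : v.valuation K c = 1),
      IsUnit (⟨algebraMap K F c, hmem hc⟩ : 𝒪[F]) := fun {c} hc ↦
    hint.isUnit_iff_valuation_eq_one.mpr (by
      change Valued.v (algebraMap K F c) = 1
      rw [hval, hc])
  have h2' : IsUnit (2 : 𝒪[F]) := by
    convert hunit hv2 using 1
    refine Subtype.ext ?_
    change ((2 : 𝒪[F]) : F) = algebraMap K _ 2
    rw [map_ofNat]
    norm_cast
  obtain ⟨x, y, hxy⟩ := exists_sq_sub_mul_sq_of_isUnit h2' (hunit hva) (hunit hvb)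
  refine ⟨x, y, x.2, y.2, ?_⟩
  simpa using congr_arg Subtype.val hxy

/-- **An adelic solution of `s² - a t² = b` away from `S`.** If `x² - a y² = b` is solvable in
`K_v` for every finite place `v ∉ S` and in `K_w` for every infinite place `w`, then there are
`s, t ∈ 𝔸_K` with `s_w² - a t_w² = b` for all infinite `w` and `(s² - a t²)_v = b` for all finite
`v ∉ S`: choose local solutions, integral ones (Hensel, `exists_integral_sq_sub_mul_sq`) at the
cofinitely many `v` where `a`, `b`, `2` are units, `0` at the places of `S`; they form an adele.
(Vignéras III §1, proof of Lemme 1.1: local splittings are integral almost everywhere.)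
[cite: VignerasLNM800, Ch. III §1 Lemme 1.1 (proof)] -/
theorem exists_adele_sq_sub_mul_sq {a b : K} (ha : a ≠ 0) (hb : b ≠ 0)
    (S : Finset (HeightOneSpectrum (𝓞 K)))
    (hS : ∀ v : HeightOneSpectrum (𝓞 K), v ∉ S →
      ∃ x y : v.adicCompletion K, x ^ 2 - algebraMap K _ a * y ^ 2 = algebraMap K _ b)
    (hi : ∀ w : InfinitePlace K, ∃ x y : w.Completion, x ^ 2 - algebraMap K _ a * y ^ 2 = algebraMap K _ b) :
    ∃ s t : AdeleRing (𝓞 K) K,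
      (∀ w : InfinitePlace K,
        (s ^ 2 - algebraMap K _ a * t ^ 2).1 w = (algebraMap K (AdeleRing (𝓞 K) K) b).1 w) ∧
      ∀ v : HeightOneSpectrum (𝓞 K), v ∉ S →
        AdelicGroupData.adeleEval K v (s ^ 2 - algebraMap K _ a * t ^ 2) =
          AdelicGroupData.adeleEval K v (algebraMap K _ b) := by
  classical
  -- the bad finite places: `a`, `b` or `2` not a unit
  set T : Set (HeightOneSpectrum (𝓞 K)) :=
    {v | v.valuation K a ≠ 1} ∪ {v | v.valuation K b ≠ 1} ∪ {v | v.valuation K (2 : K) ≠ 1} with hT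
  have hTf : T.Finite := ((finite_setOf_valuation_ne_one K ha).union (finite_setOf_valuation_ne_one K hb)).union
    (finite_setOf_valuation_ne_one K (two_ne_zero (α := K)))
  -- local choices at the finite places
  have key : ∀ v : HeightOneSpectrum (𝓞 K), ∃ p : v.adicCompletion K × v.adicCompletion K,
      (v ∉ S → p.1 ^ 2 - algebraMap K _ a * p.2 ^ 2 = algebraMap K _ b) ∧
      (v ∉ T → p.1 ∈ v.adicCompletionIntegers K ∧ p.2 ∈ v.adicCompletionIntegers K) := by
    intro v
    by_cases hvS : v ∈ S
    · exact ⟨(0, 0), fun h => (h hvS).elim, fun _ => ⟨zero_mem _, zero_mem _⟩⟩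
    · by_cases hvT : v ∈ T
      · obtain ⟨x, y, hxy⟩ := hS v hvS
        exact ⟨(x, y), fun _ => hxy, fun h => (h hvT).elim⟩
      · have hv : v.valuation K a = 1 ∧ v.valuation K b = 1 ∧ v.valuation K (2 : K) = 1 := by
          simp only [hT, Set.mem_union, Set.mem_setOf_eq, not_or, not_not] at hvT
          exact ⟨hvT.1.1, hvT.1.2, hvT.2⟩
        obtain ⟨x, y, hx, hy, hxy⟩ := exists_integral_sq_sub_mul_sq K v hv.1 hv.2.1 hv.2.2
        exact ⟨(x, y), fun _ => hxy, fun _ => ⟨hx, hy⟩⟩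
  choose p hp using key
  -- local choices at the infinite places
  choose xi yi hxyi using hi
  -- the finite adeles
  have hcof : ∀ᶠ v in Filter.cofinite, v ∉ T := hTf.compl_mem_cofinite
  let sf : FiniteAdeleRing (𝓞 K) K := ⟨fun v => (p v).1, hcof.mono fun v hv => ((hp v).2 hv).1⟩
  let tf : FiniteAdeleRing (𝓞 K) K := ⟨fun v => (p v).2, hcof.mono fun v hv => ((hp v).2 hv).2⟩
  refine ⟨(xi, sf), (yi, tf), fun w => ?_, fun v hv => ?_⟩
  · -- infinite places: everything is componentwise (definitional)
    exact hxyi w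
  · -- finite places away from `S`
    rw [map_sub, map_mul, map_pow, map_pow]
    change (p v).1 ^ 2 - AdelicGroupData.adeleEval K v (algebraMap K _ a) * (p v).2 ^ 2 =
      AdelicGroupData.adeleEval K v (algebraMap K _ b)
    have hev : ∀ c : K, AdelicGroupData.adeleEval K v (algebraMap K (AdeleRing (𝓞 K) K) c) =
        algebraMap K (v.adicCompletion K) c := fun c => by
      rw [AdelicGroupData.adeleEval_apply]
      change algebraMap K (FiniteAdeleRing (𝓞 K) K) c v = _
      rw [FiniteAdeleRing.algebraMap_apply]
      exact adicCompletion_coe_eq_algebraMap (𝓞 K) K v c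
    rw [hev, hev]
    exact (hp v).1 hv

end NormEquation

/-! ### The case of a quaternion algebra unramified at infinity -/

section Quaternion

variable (K : Type) [Field K] [NumberField K] (D : Type u) [Ring D] [Algebra K D]

/-- **For `D ≃ ℍ[K,a,b]` unramified at infinity and `S ⊇ Ram_f(D)` there are adeles `s, t` with
`s² - a t² = b` at all infinite places and at all finite places outside `S`** (local solvability =
splitting, `isSplitAt_quaternionAlgebra_iff` / `isSplitAtInfinite_quaternionAlgebra_iff` transported
along `D ≃ ℍ[K,a,b]`, then `exists_adele_sq_sub_mul_sq`). Gelbart (1975), Remark 10.7 (i): "the set of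
ramified primes in `D` does not include infinite primes". [cite: VignerasLNM800, Ch. III §3 (Ram D) with Ch. I §2 Cor. 2.4] -/
theorem exists_adele_sq_sub_mul_sq_of_ramifiedPlaces_subset {a b : K} (ha : a ≠ 0) (hb : b ≠ 0)
    (e : D ≃ₐ[K] ℍ[K,a,b]) (S : Finset (HeightOneSpectrum (𝓞 K)))
    (hS : ramifiedPlaces K D ⊆ (S : Set (HeightOneSpectrum (𝓞 K)))) (hi : ramifiedInfinitePlaces K D = ∅) :
    ∃ s t : AdeleRing (𝓞 K) K,
      (∀ w : InfinitePlace K,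
        (s ^ 2 - algebraMap K _ a * t ^ 2).1 w = (algebraMap K (AdeleRing (𝓞 K) K) b).1 w) ∧
      ∀ v : HeightOneSpectrum (𝓞 K), v ∉ S →
        AdelicGroupData.adeleEval K v (s ^ 2 - algebraMap K _ a * t ^ 2) =
          AdelicGroupData.adeleEval K v (algebraMap K _ b) := by
  refine exists_adele_sq_sub_mul_sq K ha hb S (fun v hv => ?_) (fun w => ?_)
  · have hsplit : IsSplitAt D v := by
      by_contra h
      exact hv (hS ((mem_ramifiedPlaces_iff K v).2 h))
    exact (isSplitAt_quaternionAlgebra_iff K ha hb v).1 ((isSplitAt_congr K D e v).1 hsplit)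
  · have hsplit : IsSplitAtInfinite D w := by
      by_contra h
      have : w ∈ ramifiedInfinitePlaces K D := (mem_ramifiedInfinitePlaces_iff K w).2 h
      rw [hi] at this
      exact this
    exact (isSplitAtInfinite_quaternionAlgebra_iff K ha hb w).1 ((isSplitAtInfinite_congr K D e w).1 hsplit)

end Quaternion

end Literature.NumberTheory.Automorphic
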